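import Mathlib
import Summits.KontsevichZagierPeriods.Zeta5Search.RhinViolaThetaComplex
import Summits.KontsevichZagierPeriods.Zeta5Search.RhinViolaGeneratorsComplex
import Summits.KontsevichZagierPeriods.Zeta5Search.RhinViolaIntegrable
import HarnessLib

/-!
# ζ(5) search — the Rhin–Viola word `φϑφσφχ` behind Brown–Zudilin's `h'`, with complex `z`-exponents (cell `pub-zeta5`, seat ct-1 g13)

HONEST FRAMING: systematic search; no irrationality claim unless kernel-certified. Nothing in this file is an
irrationality result, a worthiness exponent or a denominator statement. Brown–Zudilin derive the generator `h'` of their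
group `G` [BrownZudilin2022, Sect. 7] by applying Bailey's `₇F₆` transformation (25) twice to the `s`-integral of (16). The
memo `ct-1/g12/EULERSYM.md` §3/§5 identifies that step with the element `(u₁u₉)(u₅u₁₀)` of Rhin–Viola's group `Φ`
[G. Rhin, C. Viola, *The group structure for ζ(3)*, Acta Arith. 97 (2001), §4], i.e. the word `φ, ϑ, φ, σ, φ, χ` in RV's ELEMENTARY
generators, acting on the triple integral

  `T(h,l,k,s; j,q; c) = ∫_{(0,1)³} x^h(1−x)^l y^k(1−y)^s z^j(1−z)^q (1−(1−xy)z)^{−c} dx dy dz`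

with the `s`-side letters `h = p₁, l = q₁, k = p₂, s = q₂`, link exponent `c = p₀+1`, and COMPLEX `z`-exponents `j`, `q = q₁+q₂−j`
(after the Mellin decoupling of the `t`-side, `j = p₃+1+t`; RV's constraint `j+q = l+s` is Brown–Zudilin's (18)). This file chains the
six kernel theorems (`RhinViolaGeneratorsComplex.rv_phi_cpow/rv_chi_cpow`, `RhinViolaThetaComplex.rv_theta_invariance_cpow/rv_sigma_cpow`;
integrability from `RhinViolaIntegrable.rv_integrableOn_cpow`) into

  **`rv_word_hprime`**: `Γ(p₂+q₂−p₁+1)·Γ(p₁+q₁−j+1) · T(p₁,q₁,p₂,q₂; j, q₁+q₂−j; p₀+1)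
                          = Γ(p₂+1)·Γ(q₁+q₂−j+1) · T(q₂,q₁,p₂+q₂−p₁,p₁; j, p₁+q₁−j; p₀+1)`

for naturals `p₀ ≤ p₁+q₁`, `p₁ ≤ p₂+q₂` and complex `j` in the strip where all seven integrals converge absolutely — Brown–Zudilin's
`s`-side identity behind `h'` (p. 17: the factor `p₁!p₂!(q₁+q₂−p₀)!Γ(q₁+q₂−p₃−t)/(q₂!(p₁+q₁−p₀)!(p₂+q₂−p₁)!Γ(p₁+q₁−p₃−t))`, here in the
closed-`y₁,y₂` form), WITHOUT Bailey's transformation. Theorems only (no new definitions).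
-/

noncomputable section

namespace Summit.KontsevichZagierPeriods.Zeta5Search.RhinViolaWordHprime

open MeasureTheory Set Filter
open Summit.KontsevichZagierPeriods.Zeta5Search.RhinViolaThetaComplex (rv_theta_invariance_cpow rv_sigma_cpow)
open Summit.KontsevichZagierPeriods.Zeta5Search.RhinViolaGeneratorsComplex (rv_phi_cpow rv_chi_cpow)
open Summit.KontsevichZagierPeriods.Zeta5Search.RhinViolaIntegrable (rv_integrableOn_cpow)

/-! ### Congruence of the Rhin–Viola integrand in its seven exponents -/

/-- Pointwise congruence of the RV integrand in its exponents. -/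
theorem rv_pt_congr {x : Fin 3 → ℝ} {h l k s j q c h' l' k' s' j' q' c' : ℂ} (eh : h = h') (el : l = l') (ek : k = k')
    (es : s = s') (ej : j = j') (eq : q = q') (ec : c = c') :
    ((x 0 : ℝ) : ℂ) ^ h * ((1 - x 0 : ℝ) : ℂ) ^ l * ((x 1 : ℝ) : ℂ) ^ k * ((1 - x 1 : ℝ) : ℂ) ^ s * ((x 2 : ℝ) : ℂ) ^ j *
        ((1 - x 2 : ℝ) : ℂ) ^ q / ((1 - (1 - x 0 * x 1) * x 2 : ℝ) : ℂ) ^ c =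
      ((x 0 : ℝ) : ℂ) ^ h' * ((1 - x 0 : ℝ) : ℂ) ^ l' * ((x 1 : ℝ) : ℂ) ^ k' * ((1 - x 1 : ℝ) : ℂ) ^ s' *
        ((x 2 : ℝ) : ℂ) ^ j' * ((1 - x 2 : ℝ) : ℂ) ^ q' / ((1 - (1 - x 0 * x 1) * x 2 : ℝ) : ℂ) ^ c' := by
  subst eh el ek es ej eq ec; rfl

/-- Congruence of the RV triple integral in its exponents. -/
theorem rv_T_congr {h l k s j q c h' l' k' s' j' q' c' : ℂ} (eh : h = h') (el : l = l') (ek : k = k')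
    (es : s = s') (ej : j = j') (eq : q = q') (ec : c = c') :
    ∫ x in (univ.pi fun _ : Fin 3 => Ioo (0:ℝ) 1), ((x 0 : ℝ) : ℂ) ^ h * ((1 - x 0 : ℝ) : ℂ) ^ l * ((x 1 : ℝ) : ℂ) ^ k *
        ((1 - x 1 : ℝ) : ℂ) ^ s * ((x 2 : ℝ) : ℂ) ^ j * ((1 - x 2 : ℝ) : ℂ) ^ q / ((1 - (1 - x 0 * x 1) * x 2 : ℝ) : ℂ) ^ c =
      ∫ x in (univ.pi fun _ : Fin 3 => Ioo (0:ℝ) 1), ((x 0 : ℝ) : ℂ) ^ h' * ((1 - x 0 : ℝ) : ℂ) ^ l' * ((x 1 : ℝ) : ℂ) ^ k' *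
        ((1 - x 1 : ℝ) : ℂ) ^ s' * ((x 2 : ℝ) : ℂ) ^ j' * ((1 - x 2 : ℝ) : ℂ) ^ q' /
        ((1 - (1 - x 0 * x 1) * x 2 : ℝ) : ℂ) ^ c' := by
  subst eh el ek es ej eq ec; rfl

/-! ### The word -/

/-- **Brown–Zudilin's `h'`-step on the `s`-side, by Rhin–Viola's word `φϑφσφχ`** (no Bailey transformation): for naturals
`p₀ ≤ p₁+q₁`, `p₁ ≤ p₂+q₂` and complex `j` with `−1 < Re j`, `Re j < q₁+q₂+1`, `Re j < p₁+q₁+1`, `p₀ + Re j < p₁+q₁+q₂+1`,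
`p₀ + Re j < p₂+q₁+q₂+1`,
`Γ(p₂+q₂−p₁+1)Γ(p₁+q₁−j+1) · T(p₁,q₁,p₂,q₂; j, q₁+q₂−j; p₀+1) = Γ(p₂+1)Γ(q₁+q₂−j+1) · T(q₂,q₁,p₂+q₂−p₁,p₁; j, p₁+q₁−j; p₀+1)`.
[BrownZudilin2022, Sect. 7 (p. 17, the `s`-integral identity with `d ↔ e`); RV §4 (4.1)–(4.2), §2 (2.4)–(2.6)] -/
theorem rv_word_hprime (p0 p1 q1 p2 q2 : ℕ) (hside : p0 ≤ p1 + q1) (hk : p1 ≤ p2 + q2) (j : ℂ) (hj : -1 < j.re)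
    (hjQ : j.re < q1 + q2 + 1) (hjc : j.re < p1 + q1 + 1) (hA : (p0 : ℝ) + j.re < p1 + q1 + q2 + 1)
    (hB : (p0 : ℝ) + j.re < p2 + q1 + q2 + 1) :
    Complex.Gamma ((p2 : ℂ) + q2 - p1 + 1) * Complex.Gamma ((p1 : ℂ) + q1 - j + 1) *
        ∫ x in (univ.pi fun _ : Fin 3 => Ioo (0:ℝ) 1), ((x 0 : ℝ) : ℂ) ^ (p1 : ℂ) * ((1 - x 0 : ℝ) : ℂ) ^ (q1 : ℂ) *
          ((x 1 : ℝ) : ℂ) ^ (p2 : ℂ) * ((1 - x 1 : ℝ) : ℂ) ^ (q2 : ℂ) * ((x 2 : ℝ) : ℂ) ^ j *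
          ((1 - x 2 : ℝ) : ℂ) ^ ((q1 : ℂ) + q2 - j) / ((1 - (1 - x 0 * x 1) * x 2 : ℝ) : ℂ) ^ ((p0 : ℂ) + 1) =
      Complex.Gamma ((p2 : ℂ) + 1) * Complex.Gamma ((q1 : ℂ) + q2 - j + 1) *
        ∫ x in (univ.pi fun _ : Fin 3 => Ioo (0:ℝ) 1), ((x 0 : ℝ) : ℂ) ^ (q2 : ℂ) * ((1 - x 0 : ℝ) : ℂ) ^ (q1 : ℂ) *
          ((x 1 : ℝ) : ℂ) ^ ((p2 : ℂ) + q2 - p1) * ((1 - x 1 : ℝ) : ℂ) ^ (p1 : ℂ) * ((x 2 : ℝ) : ℂ) ^ j *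
          ((1 - x 2 : ℝ) : ℂ) ^ ((p1 : ℂ) + q1 - j) / ((1 - (1 - x 0 * x 1) * x 2 : ℝ) : ℂ) ^ ((p0 : ℂ) + 1) := by
  have hside' : (p0 : ℝ) ≤ p1 + q1 := by exact_mod_cast hside
  have hk' : (p1 : ℝ) ≤ p2 + q2 := by exact_mod_cast hk
  have n0 := p0.cast_nonneg (α := ℝ); have n1 := p1.cast_nonneg (α := ℝ); have m1 := q1.cast_nonneg (α := ℝ)
  have n2 := p2.cast_nonneg (α := ℝ); have m2 := q2.cast_nonneg (α := ℝ)
  -- the seven integrals converge absolutely (`RhinViolaIntegrable.rv_integrableOn_cpow`)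
  have I0 := rv_integrableOn_cpow (p1 : ℂ) (q1 : ℂ) (p2 : ℂ) (q2 : ℂ) j ((q1 : ℂ) + q2 - j) ((p0 : ℂ) + 1)
    (by simp; linarith) (by simp; linarith) (by simp; linarith) (by simp; linarith) hj (by simp; linarith)
    (by simp; linarith) (by simp; linarith)
  have I1 := rv_integrableOn_cpow (p0 : ℂ) ((p1 : ℂ) + q1 - p0) (p2 : ℂ) (q2 : ℂ) j ((q1 : ℂ) + q2 - j + p1 - p0)
    ((p1 : ℂ) + 1) (by simp; linarith) (by simp; linarith) (by simp; linarith) (by simp; linarith) hj (by simp; linarith)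
    (by simp; linarith) (by simp; linarith)
  have I2 := rv_integrableOn_cpow (q2 : ℂ) (p2 : ℂ) j ((q1 : ℂ) + q2 - j) (p0 : ℂ) ((p2 : ℂ) + ((q1 : ℂ) + q2 - j) - p0)
    ((p2 : ℂ) + q2 - p1 + 1) (by simp; linarith) (by simp; linarith) hj (by simp; linarith) (by simp; linarith)
    (by simp; linarith) (by simp; linarith) (by simp; linarith)
  have I3 := rv_integrableOn_cpow ((p2 : ℂ) + q2 - p1) (p1 : ℂ) j ((q1 : ℂ) + q2 - j) (p0 : ℂ)
    ((q1 : ℂ) + q2 - j + p1 - p0) ((q2 : ℂ) + 1) (by simp; linarith) (by simp; linarith) hj (by simp; linarith)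
    (by simp; linarith) (by simp; linarith) (by simp; linarith) (by simp; linarith)
  have I4 := rv_integrableOn_cpow j ((q1 : ℂ) + q2 - j) ((p2 : ℂ) + q2 - p1) (p1 : ℂ) (p0 : ℂ)
    ((q1 : ℂ) + q2 - j + p1 - p0) ((q2 : ℂ) + 1) hj (by simp; linarith) (by simp; linarith) (by simp; linarith)
    (by simp; linarith) (by simp; linarith) (by simp; linarith) (by simp; linarith)
  have I5 := rv_integrableOn_cpow (q2 : ℂ) (q1 : ℂ) ((p2 : ℂ) + q2 - p1) (p1 : ℂ) (p0 : ℂ) ((p1 : ℂ) + q1 - p0) (j + 1)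
    (by simp; linarith) (by simp; linarith) (by simp; linarith) (by simp; linarith) (by simp; linarith) (by simp; linarith)
    (by simp; linarith) (by simp; linarith)
  have I6 := rv_integrableOn_cpow (q2 : ℂ) (q1 : ℂ) ((p2 : ℂ) + q2 - p1) (p1 : ℂ) j ((p1 : ℂ) + q1 - j) ((p0 : ℂ) + 1)
    (by simp; linarith) (by simp; linarith) (by simp; linarith) (by simp; linarith) hj (by simp; linarith)
    (by simp; linarith) (by simp; linarith)
  -- non-vanishing Gamma values
  have G0 : Complex.Gamma ((p0 : ℂ) + 1) ≠ 0 := Complex.Gamma_ne_zero_of_re_pos (by simp; linarith)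
  have G1 : Complex.Gamma ((p1 : ℂ) + q1 - p0 + 1) ≠ 0 := Complex.Gamma_ne_zero_of_re_pos (by simp; linarith)
  have GP1 : Complex.Gamma ((p1 : ℂ) + 1) ≠ 0 := Complex.Gamma_ne_zero_of_re_pos (by simp; linarith)
  have GQ1 : Complex.Gamma ((q1 : ℂ) + 1) ≠ 0 := Complex.Gamma_ne_zero_of_re_pos (by simp; linarith)
  have GQ2 : Complex.Gamma ((q2 : ℂ) + 1) ≠ 0 := Complex.Gamma_ne_zero_of_re_pos (by simp; linarith)
  have Gj : Complex.Gamma (j + 1) ≠ 0 := Complex.Gamma_ne_zero_of_re_pos (by simp; linarith)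
  have Gk : Complex.Gamma ((p2 : ℂ) + q2 - p1 + 1) ≠ 0 := Complex.Gamma_ne_zero_of_re_pos (by simp; linarith)
  -- STEP 1: `φ` in `x` (link exponent `p₀+1 ↦ p₁+1`)
  have S1 : Complex.Gamma ((p0 : ℂ) + 1) * Complex.Gamma ((p1 : ℂ) + q1 - p0 + 1) *
      (∫ x in (univ.pi fun _ : Fin 3 => Ioo (0:ℝ) 1), ((x 0 : ℝ) : ℂ) ^ (p1 : ℂ) * ((1 - x 0 : ℝ) : ℂ) ^ (q1 : ℂ) *
          ((x 1 : ℝ) : ℂ) ^ (p2 : ℂ) * ((1 - x 1 : ℝ) : ℂ) ^ (q2 : ℂ) * ((x 2 : ℝ) : ℂ) ^ j *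
          ((1 - x 2 : ℝ) : ℂ) ^ ((q1 : ℂ) + q2 - j) / ((1 - (1 - x 0 * x 1) * x 2 : ℝ) : ℂ) ^ ((p0 : ℂ) + 1)) =
      Complex.Gamma ((p1 : ℂ) + 1) * Complex.Gamma ((q1 : ℂ) + 1) *
      ∫ x in (univ.pi fun _ : Fin 3 => Ioo (0:ℝ) 1), ((x 0 : ℝ) : ℂ) ^ (p0 : ℂ) * ((1 - x 0 : ℝ) : ℂ) ^ ((p1 : ℂ) + q1 - p0) *
          ((x 1 : ℝ) : ℂ) ^ (p2 : ℂ) * ((1 - x 1 : ℝ) : ℂ) ^ (q2 : ℂ) * ((x 2 : ℝ) : ℂ) ^ j *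
          ((1 - x 2 : ℝ) : ℂ) ^ ((q1 : ℂ) + q2 - j + p1 - p0) / ((1 - (1 - x 0 * x 1) * x 2 : ℝ) : ℂ) ^ ((p1 : ℂ) + 1) := by
    have h := rv_phi_cpow (p1 : ℂ) (q1 : ℂ) (p2 : ℂ) (q2 : ℂ) j ((q1 : ℂ) + q2 - j) ((p0 : ℂ) + 1)
      (by simp; linarith) (by simp; linarith) (by simp; linarith) (by simp; linarith) I0
      (I1.congr_fun (fun x _ => rv_pt_congr (by ring) (by ring) rfl rfl rfl (by ring) rfl)
        (RhinViolaGenerators.measurableSet_cube 3))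
    rw [show (p1 : ℂ) + q1 + 2 - ((p0 : ℂ) + 1) = (p1 : ℂ) + q1 - p0 + 1 by ring] at h
    refine h.trans ?_
    congr 1
    exact rv_T_congr (by ring) (by ring) rfl rfl rfl (by ring) rfl
  -- STEP 2: `ϑ` (the constraint `j + q = l + s` is Brown–Zudilin's (18))
  have S2 : (∫ x in (univ.pi fun _ : Fin 3 => Ioo (0:ℝ) 1), ((x 0 : ℝ) : ℂ) ^ (p0 : ℂ) * ((1 - x 0 : ℝ) : ℂ) ^ ((p1 : ℂ) + q1 - p0) *
          ((x 1 : ℝ) : ℂ) ^ (p2 : ℂ) * ((1 - x 1 : ℝ) : ℂ) ^ (q2 : ℂ) * ((x 2 : ℝ) : ℂ) ^ j *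
          ((1 - x 2 : ℝ) : ℂ) ^ ((q1 : ℂ) + q2 - j + p1 - p0) / ((1 - (1 - x 0 * x 1) * x 2 : ℝ) : ℂ) ^ ((p1 : ℂ) + 1)) =
      ∫ x in (univ.pi fun _ : Fin 3 => Ioo (0:ℝ) 1), ((x 0 : ℝ) : ℂ) ^ (q2 : ℂ) * ((1 - x 0 : ℝ) : ℂ) ^ (p2 : ℂ) *
          ((x 1 : ℝ) : ℂ) ^ j * ((1 - x 1 : ℝ) : ℂ) ^ ((q1 : ℂ) + q2 - j) * ((x 2 : ℝ) : ℂ) ^ (p0 : ℂ) *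
          ((1 - x 2 : ℝ) : ℂ) ^ ((p2 : ℂ) + ((q1 : ℂ) + q2 - j) - p0) /
          ((1 - (1 - x 0 * x 1) * x 2 : ℝ) : ℂ) ^ ((p2 : ℂ) + q2 - p1 + 1) := by
    refine (rv_theta_invariance_cpow (p0 : ℂ) ((p1 : ℂ) + q1 - p0) (p2 : ℂ) (q2 : ℂ) j ((q1 : ℂ) + q2 - j + p1 - p0)
      ((p1 : ℂ) + 1) (by ring)).trans ?_
    exact rv_T_congr rfl rfl rfl (by ring) rfl (by ring) (by ring)
  -- STEP 3: `φ` in `x` (link exponent `p₂+q₂−p₁+1 ↦ q₂+1`)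
  have S3 : Complex.Gamma ((p2 : ℂ) + q2 - p1 + 1) * Complex.Gamma ((p1 : ℂ) + 1) *
      (∫ x in (univ.pi fun _ : Fin 3 => Ioo (0:ℝ) 1), ((x 0 : ℝ) : ℂ) ^ (q2 : ℂ) * ((1 - x 0 : ℝ) : ℂ) ^ (p2 : ℂ) *
          ((x 1 : ℝ) : ℂ) ^ j * ((1 - x 1 : ℝ) : ℂ) ^ ((q1 : ℂ) + q2 - j) * ((x 2 : ℝ) : ℂ) ^ (p0 : ℂ) *
          ((1 - x 2 : ℝ) : ℂ) ^ ((p2 : ℂ) + ((q1 : ℂ) + q2 - j) - p0) /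
          ((1 - (1 - x 0 * x 1) * x 2 : ℝ) : ℂ) ^ ((p2 : ℂ) + q2 - p1 + 1)) =
      Complex.Gamma ((q2 : ℂ) + 1) * Complex.Gamma ((p2 : ℂ) + 1) *
      ∫ x in (univ.pi fun _ : Fin 3 => Ioo (0:ℝ) 1), ((x 0 : ℝ) : ℂ) ^ ((p2 : ℂ) + q2 - p1) * ((1 - x 0 : ℝ) : ℂ) ^ (p1 : ℂ) *
          ((x 1 : ℝ) : ℂ) ^ j * ((1 - x 1 : ℝ) : ℂ) ^ ((q1 : ℂ) + q2 - j) * ((x 2 : ℝ) : ℂ) ^ (p0 : ℂ) *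
          ((1 - x 2 : ℝ) : ℂ) ^ ((q1 : ℂ) + q2 - j + p1 - p0) / ((1 - (1 - x 0 * x 1) * x 2 : ℝ) : ℂ) ^ ((q2 : ℂ) + 1) := by
    have h := rv_phi_cpow (q2 : ℂ) (p2 : ℂ) j ((q1 : ℂ) + q2 - j) (p0 : ℂ) ((p2 : ℂ) + ((q1 : ℂ) + q2 - j) - p0)
      ((p2 : ℂ) + q2 - p1 + 1) (by simp; linarith) (by simp; linarith) (by simp; linarith) (by simp; linarith) I2
      (I3.congr_fun (fun x _ => rv_pt_congr (by ring) (by ring) rfl rfl rfl (by ring) rfl)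
        (RhinViolaGenerators.measurableSet_cube 3))
    rw [show (q2 : ℂ) + p2 + 2 - ((p2 : ℂ) + q2 - p1 + 1) = (p1 : ℂ) + 1 by ring] at h
    refine h.trans ?_
    congr 1
    exact rv_T_congr (by ring) (by ring) rfl rfl rfl (by ring) rfl
  -- STEP 4: `σ` (swap `x ↔ y`)
  have S4 : (∫ x in (univ.pi fun _ : Fin 3 => Ioo (0:ℝ) 1), ((x 0 : ℝ) : ℂ) ^ ((p2 : ℂ) + q2 - p1) * ((1 - x 0 : ℝ) : ℂ) ^ (p1 : ℂ) *
          ((x 1 : ℝ) : ℂ) ^ j * ((1 - x 1 : ℝ) : ℂ) ^ ((q1 : ℂ) + q2 - j) * ((x 2 : ℝ) : ℂ) ^ (p0 : ℂ) *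
          ((1 - x 2 : ℝ) : ℂ) ^ ((q1 : ℂ) + q2 - j + p1 - p0) / ((1 - (1 - x 0 * x 1) * x 2 : ℝ) : ℂ) ^ ((q2 : ℂ) + 1)) =
      ∫ x in (univ.pi fun _ : Fin 3 => Ioo (0:ℝ) 1), ((x 0 : ℝ) : ℂ) ^ j * ((1 - x 0 : ℝ) : ℂ) ^ ((q1 : ℂ) + q2 - j) *
          ((x 1 : ℝ) : ℂ) ^ ((p2 : ℂ) + q2 - p1) * ((1 - x 1 : ℝ) : ℂ) ^ (p1 : ℂ) * ((x 2 : ℝ) : ℂ) ^ (p0 : ℂ) *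
          ((1 - x 2 : ℝ) : ℂ) ^ ((q1 : ℂ) + q2 - j + p1 - p0) / ((1 - (1 - x 0 * x 1) * x 2 : ℝ) : ℂ) ^ ((q2 : ℂ) + 1) :=
    rv_sigma_cpow _ _ _ _ _ _ _
  -- STEP 5: `φ` in `x`, now with COMPLEX `x`-exponents (link exponent `q₂+1 ↦ j+1`)
  have S5 : Complex.Gamma ((q2 : ℂ) + 1) * Complex.Gamma ((q1 : ℂ) + 1) *
      (∫ x in (univ.pi fun _ : Fin 3 => Ioo (0:ℝ) 1), ((x 0 : ℝ) : ℂ) ^ j * ((1 - x 0 : ℝ) : ℂ) ^ ((q1 : ℂ) + q2 - j) *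
          ((x 1 : ℝ) : ℂ) ^ ((p2 : ℂ) + q2 - p1) * ((1 - x 1 : ℝ) : ℂ) ^ (p1 : ℂ) * ((x 2 : ℝ) : ℂ) ^ (p0 : ℂ) *
          ((1 - x 2 : ℝ) : ℂ) ^ ((q1 : ℂ) + q2 - j + p1 - p0) / ((1 - (1 - x 0 * x 1) * x 2 : ℝ) : ℂ) ^ ((q2 : ℂ) + 1)) =
      Complex.Gamma (j + 1) * Complex.Gamma ((q1 : ℂ) + q2 - j + 1) *
      ∫ x in (univ.pi fun _ : Fin 3 => Ioo (0:ℝ) 1), ((x 0 : ℝ) : ℂ) ^ (q2 : ℂ) * ((1 - x 0 : ℝ) : ℂ) ^ (q1 : ℂ) *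
          ((x 1 : ℝ) : ℂ) ^ ((p2 : ℂ) + q2 - p1) * ((1 - x 1 : ℝ) : ℂ) ^ (p1 : ℂ) * ((x 2 : ℝ) : ℂ) ^ (p0 : ℂ) *
          ((1 - x 2 : ℝ) : ℂ) ^ ((p1 : ℂ) + q1 - p0) / ((1 - (1 - x 0 * x 1) * x 2 : ℝ) : ℂ) ^ (j + 1) := by
    have h := rv_phi_cpow j ((q1 : ℂ) + q2 - j) ((p2 : ℂ) + q2 - p1) (p1 : ℂ) (p0 : ℂ) ((q1 : ℂ) + q2 - j + p1 - p0)
      ((q2 : ℂ) + 1) hj (by simp; linarith) (by simp; linarith) (by simp; linarith) I4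
      (I5.congr_fun (fun x _ => rv_pt_congr (by ring) (by ring) rfl rfl rfl (by ring) rfl)
        (RhinViolaGenerators.measurableSet_cube 3))
    rw [show j + ((q1 : ℂ) + q2 - j) + 2 - ((q2 : ℂ) + 1) = (q1 : ℂ) + 1 by ring,
      show (q1 : ℂ) + q2 - j + 1 = ((q1 : ℂ) + q2 - j) + 1 by ring] at h
    rw [show (q1 : ℂ) + q2 - j + 1 = ((q1 : ℂ) + q2 - j) + 1 by ring]
    refine h.trans ?_
    congr 1
    exact rv_T_congr (by ring) (by ring) rfl rfl rfl (by ring) rfl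
  -- STEP 6: `χ` in `z` (link exponent `j+1 ↦ p₀+1`)
  have S6 : Complex.Gamma (j + 1) * Complex.Gamma ((p1 : ℂ) + q1 - j + 1) *
      (∫ x in (univ.pi fun _ : Fin 3 => Ioo (0:ℝ) 1), ((x 0 : ℝ) : ℂ) ^ (q2 : ℂ) * ((1 - x 0 : ℝ) : ℂ) ^ (q1 : ℂ) *
          ((x 1 : ℝ) : ℂ) ^ ((p2 : ℂ) + q2 - p1) * ((1 - x 1 : ℝ) : ℂ) ^ (p1 : ℂ) * ((x 2 : ℝ) : ℂ) ^ (p0 : ℂ) *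
          ((1 - x 2 : ℝ) : ℂ) ^ ((p1 : ℂ) + q1 - p0) / ((1 - (1 - x 0 * x 1) * x 2 : ℝ) : ℂ) ^ (j + 1)) =
      Complex.Gamma ((p0 : ℂ) + 1) * Complex.Gamma ((p1 : ℂ) + q1 - p0 + 1) *
      ∫ x in (univ.pi fun _ : Fin 3 => Ioo (0:ℝ) 1), ((x 0 : ℝ) : ℂ) ^ (q2 : ℂ) * ((1 - x 0 : ℝ) : ℂ) ^ (q1 : ℂ) *
          ((x 1 : ℝ) : ℂ) ^ ((p2 : ℂ) + q2 - p1) * ((1 - x 1 : ℝ) : ℂ) ^ (p1 : ℂ) * ((x 2 : ℝ) : ℂ) ^ j *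
          ((1 - x 2 : ℝ) : ℂ) ^ ((p1 : ℂ) + q1 - j) / ((1 - (1 - x 0 * x 1) * x 2 : ℝ) : ℂ) ^ ((p0 : ℂ) + 1) := by
    have h := rv_chi_cpow (q2 : ℂ) (q1 : ℂ) ((p2 : ℂ) + q2 - p1) (p1 : ℂ) (p0 : ℂ) ((p1 : ℂ) + q1 - p0) (j + 1)
      (by simp; linarith) (by simp; linarith) (by simp; linarith) (by simp; linarith) I5
      (I6.congr_fun (fun x _ => rv_pt_congr rfl rfl rfl rfl (by ring) (by ring) (by ring))
        (RhinViolaGenerators.measurableSet_cube 3))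
    rw [show (p0 : ℂ) + ((p1 : ℂ) + q1 - p0) + 2 - (j + 1) = (p1 : ℂ) + q1 - j + 1 by ring] at h
    refine h.trans ?_
    congr 1
    exact rv_T_congr rfl rfl rfl rfl (by ring) (by ring) (by ring)
  -- assemble the constants
  rw [S2] at S1
  rw [S4] at S3
  generalize (∫ x in (univ.pi fun _ : Fin 3 => Ioo (0:ℝ) 1), ((x 0 : ℝ) : ℂ) ^ (p1 : ℂ) * ((1 - x 0 : ℝ) : ℂ) ^ (q1 : ℂ) *
          ((x 1 : ℝ) : ℂ) ^ (p2 : ℂ) * ((1 - x 1 : ℝ) : ℂ) ^ (q2 : ℂ) * ((x 2 : ℝ) : ℂ) ^ j *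
          ((1 - x 2 : ℝ) : ℂ) ^ ((q1 : ℂ) + q2 - j) / ((1 - (1 - x 0 * x 1) * x 2 : ℝ) : ℂ) ^ ((p0 : ℂ) + 1)) = A at S1 ⊢
  generalize (∫ x in (univ.pi fun _ : Fin 3 => Ioo (0:ℝ) 1), ((x 0 : ℝ) : ℂ) ^ (q2 : ℂ) * ((1 - x 0 : ℝ) : ℂ) ^ (p2 : ℂ) *
          ((x 1 : ℝ) : ℂ) ^ j * ((1 - x 1 : ℝ) : ℂ) ^ ((q1 : ℂ) + q2 - j) * ((x 2 : ℝ) : ℂ) ^ (p0 : ℂ) *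
          ((1 - x 2 : ℝ) : ℂ) ^ ((p2 : ℂ) + ((q1 : ℂ) + q2 - j) - p0) /
          ((1 - (1 - x 0 * x 1) * x 2 : ℝ) : ℂ) ^ ((p2 : ℂ) + q2 - p1 + 1)) = B at S1 S3
  generalize (∫ x in (univ.pi fun _ : Fin 3 => Ioo (0:ℝ) 1), ((x 0 : ℝ) : ℂ) ^ j * ((1 - x 0 : ℝ) : ℂ) ^ ((q1 : ℂ) + q2 - j) *
          ((x 1 : ℝ) : ℂ) ^ ((p2 : ℂ) + q2 - p1) * ((1 - x 1 : ℝ) : ℂ) ^ (p1 : ℂ) * ((x 2 : ℝ) : ℂ) ^ (p0 : ℂ) *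
          ((1 - x 2 : ℝ) : ℂ) ^ ((q1 : ℂ) + q2 - j + p1 - p0) / ((1 - (1 - x 0 * x 1) * x 2 : ℝ) : ℂ) ^ ((q2 : ℂ) + 1)) = C
    at S3 S5
  generalize (∫ x in (univ.pi fun _ : Fin 3 => Ioo (0:ℝ) 1), ((x 0 : ℝ) : ℂ) ^ (q2 : ℂ) * ((1 - x 0 : ℝ) : ℂ) ^ (q1 : ℂ) *
          ((x 1 : ℝ) : ℂ) ^ ((p2 : ℂ) + q2 - p1) * ((1 - x 1 : ℝ) : ℂ) ^ (p1 : ℂ) * ((x 2 : ℝ) : ℂ) ^ (p0 : ℂ) *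
          ((1 - x 2 : ℝ) : ℂ) ^ ((p1 : ℂ) + q1 - p0) / ((1 - (1 - x 0 * x 1) * x 2 : ℝ) : ℂ) ^ (j + 1)) = D at S5 S6
  generalize (∫ x in (univ.pi fun _ : Fin 3 => Ioo (0:ℝ) 1), ((x 0 : ℝ) : ℂ) ^ (q2 : ℂ) * ((1 - x 0 : ℝ) : ℂ) ^ (q1 : ℂ) *
          ((x 1 : ℝ) : ℂ) ^ ((p2 : ℂ) + q2 - p1) * ((1 - x 1 : ℝ) : ℂ) ^ (p1 : ℂ) * ((x 2 : ℝ) : ℂ) ^ j *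
          ((1 - x 2 : ℝ) : ℂ) ^ ((p1 : ℂ) + q1 - j) / ((1 - (1 - x 0 * x 1) * x 2 : ℝ) : ℂ) ^ ((p0 : ℂ) + 1)) = E at S6 ⊢
  -- `A, B, C, D, E` in terms of each other
  have hA' : A = Complex.Gamma ((p1 : ℂ) + 1) * Complex.Gamma ((q1 : ℂ) + 1) /
      (Complex.Gamma ((p0 : ℂ) + 1) * Complex.Gamma ((p1 : ℂ) + q1 - p0 + 1)) * B := by
    rw [div_mul_eq_mul_div, eq_div_iff (mul_ne_zero G0 G1)]; linear_combination S1
  have hB' : B = Complex.Gamma ((q2 : ℂ) + 1) * Complex.Gamma ((p2 : ℂ) + 1) /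
      (Complex.Gamma ((p2 : ℂ) + q2 - p1 + 1) * Complex.Gamma ((p1 : ℂ) + 1)) * C := by
    rw [div_mul_eq_mul_div, eq_div_iff (mul_ne_zero Gk GP1)]; linear_combination S3
  have hC' : C = Complex.Gamma (j + 1) * Complex.Gamma ((q1 : ℂ) + q2 - j + 1) /
      (Complex.Gamma ((q2 : ℂ) + 1) * Complex.Gamma ((q1 : ℂ) + 1)) * D := by
    rw [div_mul_eq_mul_div, eq_div_iff (mul_ne_zero GQ2 GQ1)]; linear_combination S5
  have hD' : D = Complex.Gamma ((p0 : ℂ) + 1) * Complex.Gamma ((p1 : ℂ) + q1 - p0 + 1) /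
      (Complex.Gamma (j + 1) * Complex.Gamma ((p1 : ℂ) + q1 - j + 1)) * E := by
    have Gj' : Complex.Gamma ((p1 : ℂ) + q1 - j + 1) ≠ 0 := Complex.Gamma_ne_zero_of_re_pos (by simp; linarith)
    rw [div_mul_eq_mul_div, eq_div_iff (mul_ne_zero Gj Gj')]; linear_combination S6
  have Gj' : Complex.Gamma ((p1 : ℂ) + q1 - j + 1) ≠ 0 := Complex.Gamma_ne_zero_of_re_pos (by simp; linarith)
  rw [hA', hB', hC', hD']
  field_simp

end Summit.KontsevichZagierPeriods.Zeta5Search.RhinViolaWordHprime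

end
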